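import Mathlib
import Literature.Computability.AlgebraicComplexity.StandardFamilies
import Literature.Computability.AlgebraicComplexity.StandardFamiliesProofs
import Summits.ValiantsHypothesis.ValiantsHypothesis.Theorems.ElementaryWordLengthWordLengthQPStubUnivariateReduction
import Summits.ValiantsHypothesis.ValiantsHypothesis.Theorems.ElementaryWordLengthWordLengthQPStubRestriction

/-!
# The typed neighbourhood of the sign-budget bet `S` (line `positive-monoid-exits`, crux `WordLengthQP`, stmt-ValiantsHypothesis-6623)

The line's skeleton (`Cruxes/WordLengthQP/Lines/positive_monoid_exits.lean`) surrounds its one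
EVH-strength stub `stub_signBudgetClimb` (the bet `S`: real words for `E₀₂(per_n)` need
super-quasi-polynomially many EXITS from Lusztig's positive monoid) with four typed statements —
the monomial ladder, bounded exit generation, the FORK (exit-to-length normalisation) and the
length budget.  This file lands, unconditionally and with every statement INLINED (no new
definitions), the logical wiring between them that the lead established in cycle 1:

* `aeval_diag_perPoly_le`, `exists_word_prodX_of_word_per` — the 0/1-restriction
  `per_n ↦ x₀⋯x_{d-1}` (`d ≤ n`) never increases exits (via the landed `stub_restriction`), so
  `κ(per_n) ≥ κ(x₁⋯x_d)`;
* `monomialLadder_of_univariateLadder` — growth of the univariate table `κ₁(t^D)` gives the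
  monomial ladder (via the landed `stub_univariateReduction`);
* `stub_perExitsUnbounded` (registered stub) — the monomial ladder gives EVERY FIXED RUNG of `S` at
  once: for each `K`, eventually in `n`, every real word for `E₀₂(per_n)` has more than `K` exits;
* `not_boundedExits_of_monomialLadder` — in particular it kills the universal-construction
  failure mode ("`K` exits suffice for every `per_n`");
* `fork_of_signBudget`, `fork_of_qpRealWords`, `signBudget_iff_lengthBudget_of_fork` — the FORK is
  sandwiched `(¬X_ℝ ∨ S) → FORK → (LengthBudget → S)`: it is the question whether `S` is
  equivalent to the length statement, not an independent structural target.

Exits of a word `w` (letters `(i, j, c, v)` ↦ `E_ij(c)` / `E_ij(c·x_v)`): the number of letters that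
are NOT (positive coefficient and adjacent, `|i - j| = 1`).  References: [BenOrCleve1992] Thm 1
(elementary words); [Valiant1980] Lemma 3 and [JerrumSnir1982] §4.3 for the monotone background of
`S`; the lead's analysis `analysis-a1.md` (item evidence) for the paper results around it.
-/

set_option linter.dupNamespace false

noncomputable section

namespace Summit.ValiantsHypothesis.ValiantsHypothesis.Cruxes.WordLengthQP.PositiveMonoidExits

open Literature.Computability.AlgebraicComplexity

/-! ## 0/1-restriction of the permanent to a diagonal monomial -/

/-- The diagonal restriction `per_n ↦ x₀⋯x_{d-1}` for `d ≤ n`: kill the off-diagonal variables,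
rename `x_ii ↦ x_i` for `i < d` and set `x_ii ↦ 1` for `i ≥ d`. [folklore] -/
theorem aeval_diag_perPoly_le (d n : ℕ) (hdn : d ≤ n) :
    MvPolynomial.aeval (fun v : Fin n × Fin n =>
        (if v.1 = v.2 then (if h : v.1.val < d then some (some (⟨v.1.val, h⟩ : Fin d)) else some none)
          else (none : Option (Option (Fin d)))).elim
          (0 : MvPolynomial (Fin d) ℝ) (fun o => o.elim 1 MvPolynomial.X)) (perPoly (Fin n) ℝ) =
      ∏ i : Fin d, (MvPolynomial.X i : MvPolynomial (Fin d) ℝ) := by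
  obtain ⟨m, rfl⟩ := Nat.exists_eq_add_of_le hdn
  set g : Fin (d + m) × Fin (d + m) → MvPolynomial (Fin d) ℝ := fun v =>
    (if v.1 = v.2 then (if h : v.1.val < d then some (some (⟨v.1.val, h⟩ : Fin d)) else some none)
      else (none : Option (Option (Fin d)))).elim
      (0 : MvPolynomial (Fin d) ℝ) (fun o => o.elim 1 MvPolynomial.X) with hg
  set δ : Fin (d + m) → MvPolynomial (Fin d) ℝ := fun i =>
    if h : i.val < d then MvPolynomial.X (⟨i.val, h⟩ : Fin d) else 1 with hδ
  have hmat : (Matrix.mvPolynomialX (Fin (d + m)) (Fin (d + m)) ℝ).map (MvPolynomial.aeval g) =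
      Matrix.diagonal δ := by
    ext i j
    by_cases hij : i = j
    · subst hij
      by_cases h : i.val < d
      · simp [Matrix.mvPolynomialX, hg, hδ, h]
      · simp [Matrix.mvPolynomialX, hg, hδ, h]
    · simp [Matrix.mvPolynomialX, hg, hij]
  have hper : MvPolynomial.aeval g (perPoly (Fin (d + m)) ℝ) = (Matrix.diagonal δ).permanent := by
    unfold perPoly
    rw [Matrix.permanent, map_sum, Matrix.permanent]
    refine Finset.sum_congr rfl fun ρ _ => ?_
    rw [map_prod]
    refine Finset.prod_congr rfl fun i _ => ?_
    have := congrFun (congrFun hmat (ρ i)) i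
    simpa [Matrix.map_apply] using this
  rw [hper, Matrix.permanent_diagonal, Fin.prod_univ_add]
  have h1 : ∏ i : Fin d, δ (Fin.castAdd m i) =
      ∏ i : Fin d, (MvPolynomial.X i : MvPolynomial (Fin d) ℝ) := by
    refine Finset.prod_congr rfl fun i _ => ?_
    simp [hδ, i.isLt]
  have h2 : ∏ i : Fin m, δ (Fin.natAdd d i) = 1 := by
    refine Finset.prod_eq_one fun i _ => ?_
    simp [hδ]
  rw [h1, h2, mul_one]

/-- **0/1-restriction never increases exits**: a real word for `E₀₂(per_n)` yields, for every
`d ≤ n`, a real word for `E₀₂(x₀⋯x_{d-1})` over `Fin d` with no more exits — so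
`κ(per_n) ≥ κ(x₁⋯x_d)` (triage r2-1 doubt (2), now a theorem via `stub_restriction`). [folklore] -/
theorem exists_word_prodX_of_word_per (d n : ℕ) (hdn : d ≤ n)
    (w : List (Fin 3 × Fin 3 × ℝ × Option (Fin n × Fin n))) (hw : ∀ l ∈ w, l.1 ≠ l.2.1)
    (hprod : (w.map (fun l => Matrix.transvection l.1 l.2.1
        (MvPolynomial.C l.2.2.1 * l.2.2.2.elim 1 MvPolynomial.X))).prod =
        Matrix.transvection (0 : Fin 3) 2 (perPoly (Fin n) ℝ)) :
    ∃ w₁ : List (Fin 3 × Fin 3 × ℝ × Option (Fin d)),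
      (∀ l ∈ w₁, l.1 ≠ l.2.1) ∧
      (w₁.map (fun l => Matrix.transvection l.1 l.2.1
        (MvPolynomial.C l.2.2.1 * l.2.2.2.elim 1 MvPolynomial.X))).prod =
        Matrix.transvection (0 : Fin 3) 2 (∏ i : Fin d, (MvPolynomial.X i : MvPolynomial (Fin d) ℝ)) ∧
      (w₁.filter (fun l => !decide (0 < l.2.2.1 ∧
          (l.1.val + 1 = l.2.1.val ∨ l.2.1.val + 1 = l.1.val)))).length ≤
        (w.filter (fun l => !decide (0 < l.2.2.1 ∧
          (l.1.val + 1 = l.2.1.val ∨ l.2.1.val + 1 = l.1.val)))).length := by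
  obtain ⟨w₁, hvalid₁, hprod₁, hexits₁, -⟩ :=
    stub_restriction (fun v : Fin n × Fin n =>
      if v.1 = v.2 then (if h : v.1.val < d then some (some (⟨v.1.val, h⟩ : Fin d)) else some none)
        else (none : Option (Option (Fin d)))) _ w hw hprod
  rw [aeval_diag_perPoly_le d n hdn] at hprod₁
  exact ⟨w₁, hvalid₁, hprod₁, hexits₁⟩

/-! ## The monomial ladder: from its univariate shadow, and what it gives for the permanent -/

/-- **The monomial ladder follows from its univariate shadow**: if for every `k` some power `t^d`
needs more than `k` exits in the univariate arena (`x_v ↦ t`), then for every `k` some monomial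
`x₀⋯x_{d-1}` needs more than `k` exits (a word for the monomial maps to a word for `t^d` with the
same exits, `stub_univariateReduction`).  So the kit tables `κ₁(t^D)` are lower-bound evidence for
the ladder itself. [folklore] -/
theorem monomialLadder_of_univariateLadder
    (H : ∀ k : ℕ, ∃ d : ℕ, ∀ w₁ : List (Fin 3 × Fin 3 × ℝ × Option (Fin 1)),
      (∀ l ∈ w₁, l.1 ≠ l.2.1) →
      (w₁.map (fun l => Matrix.transvection l.1 l.2.1
        (MvPolynomial.C l.2.2.1 * l.2.2.2.elim 1 MvPolynomial.X))).prod =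
        Matrix.transvection (0 : Fin 3) 2 ((MvPolynomial.X 0 : MvPolynomial (Fin 1) ℝ) ^ d) →
      k < (w₁.filter (fun l => !decide (0 < l.2.2.1 ∧
          (l.1.val + 1 = l.2.1.val ∨ l.2.1.val + 1 = l.1.val)))).length)
    (k : ℕ) :
    ∃ d : ℕ, ∀ w : List (Fin 3 × Fin 3 × ℝ × Option (Fin d)), (∀ l ∈ w, l.1 ≠ l.2.1) →
      (w.map (fun l => Matrix.transvection l.1 l.2.1
        (MvPolynomial.C l.2.2.1 * l.2.2.2.elim 1 MvPolynomial.X))).prod =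
        Matrix.transvection (0 : Fin 3) 2 (∏ i : Fin d, (MvPolynomial.X i : MvPolynomial (Fin d) ℝ)) →
      k < (w.filter (fun l => !decide (0 < l.2.2.1 ∧
          (l.1.val + 1 = l.2.1.val ∨ l.2.1.val + 1 = l.1.val)))).length := by
  obtain ⟨d, hd⟩ := H k
  refine ⟨d, fun w hvalid hprod => ?_⟩
  obtain ⟨w₁, hvalid₁, hprod₁, hexits₁, -⟩ := stub_univariateReduction _ w hvalid hprod
  have hren : MvPolynomial.rename (fun _ : Fin d => (0 : Fin 1))
      (∏ i : Fin d, (MvPolynomial.X i : MvPolynomial (Fin d) ℝ)) =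
      (MvPolynomial.X 0 : MvPolynomial (Fin 1) ℝ) ^ d := by
    rw [map_prod]
    simp [MvPolynomial.rename_X, Finset.prod_const]
  rw [hren] at hprod₁
  have h := hd w₁ hvalid₁ hprod₁
  rw [hexits₁] at h
  exact h

/-- **The monomial ladder gives every fixed rung of `S`**: if for every `K` some monomial
`x₀⋯x_{d-1}` needs more than `K` exits, then for every `K`, for all `n ≥ d(K)`, EVERY real word
computing `E₀₂(per_n)` has more than `K` exits (restrict `per_n ↦ x₀⋯x_{d-1}`,
`exists_word_prodX_of_word_per`).  What remains of the bet `S` beyond the (per/det-symmetric)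
monomial ladder is exactly the super-quasi-polynomial RATE. [folklore] -/
theorem stub_perExitsUnbounded
    (hM : ∀ k : ℕ, ∃ d : ℕ, ∀ w : List (Fin 3 × Fin 3 × ℝ × Option (Fin d)), (∀ l ∈ w, l.1 ≠ l.2.1) →
      (w.map (fun l => Matrix.transvection l.1 l.2.1
        (MvPolynomial.C l.2.2.1 * l.2.2.2.elim 1 MvPolynomial.X))).prod =
        Matrix.transvection (0 : Fin 3) 2 (∏ i : Fin d, (MvPolynomial.X i : MvPolynomial (Fin d) ℝ)) →
      k < (w.filter (fun l => !decide (0 < l.2.2.1 ∧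
          (l.1.val + 1 = l.2.1.val ∨ l.2.1.val + 1 = l.1.val)))).length)
    (K : ℕ) :
    ∃ n₀ : ℕ, ∀ n ≥ n₀, ∀ w : List (Fin 3 × Fin 3 × ℝ × Option (Fin n × Fin n)),
      (∀ l ∈ w, l.1 ≠ l.2.1) →
      (w.map (fun l => Matrix.transvection l.1 l.2.1
        (MvPolynomial.C l.2.2.1 * l.2.2.2.elim 1 MvPolynomial.X))).prod =
        Matrix.transvection (0 : Fin 3) 2 (perPoly (Fin n) ℝ) →
      K < (w.filter (fun l => !decide (0 < l.2.2.1 ∧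
          (l.1.val + 1 = l.2.1.val ∨ l.2.1.val + 1 = l.1.val)))).length := by
  obtain ⟨d, hd⟩ := hM K
  refine ⟨d, fun n hn w hvalid hprod => ?_⟩
  obtain ⟨w₁, hvalid₁, hprod₁, hexits₁⟩ := exists_word_prodX_of_word_per d n hn w hvalid hprod
  exact lt_of_lt_of_le (hd w₁ hvalid₁ hprod₁) hexits₁

/-- **The monomial ladder kills bounded exit generation**: if for every `K` some monomial needs
more than `K` exits, then no fixed `K` serves every `per_n`. [folklore] -/
theorem not_boundedExits_of_monomialLadder
    (hM : ∀ k : ℕ, ∃ d : ℕ, ∀ w : List (Fin 3 × Fin 3 × ℝ × Option (Fin d)), (∀ l ∈ w, l.1 ≠ l.2.1) →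
      (w.map (fun l => Matrix.transvection l.1 l.2.1
        (MvPolynomial.C l.2.2.1 * l.2.2.2.elim 1 MvPolynomial.X))).prod =
        Matrix.transvection (0 : Fin 3) 2 (∏ i : Fin d, (MvPolynomial.X i : MvPolynomial (Fin d) ℝ)) →
      k < (w.filter (fun l => !decide (0 < l.2.2.1 ∧
          (l.1.val + 1 = l.2.1.val ∨ l.2.1.val + 1 = l.1.val)))).length) :
    ¬ ∃ K : ℕ, ∀ n : ℕ, ∃ w : List (Fin 3 × Fin 3 × ℝ × Option (Fin n × Fin n)),
      (∀ l ∈ w, l.1 ≠ l.2.1) ∧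
      (w.map (fun l => Matrix.transvection l.1 l.2.1
        (MvPolynomial.C l.2.2.1 * l.2.2.2.elim 1 MvPolynomial.X))).prod =
        Matrix.transvection (0 : Fin 3) 2 (perPoly (Fin n) ℝ) ∧
      (w.filter (fun l => !decide (0 < l.2.2.1 ∧
          (l.1.val + 1 = l.2.1.val ∨ l.2.1.val + 1 = l.1.val)))).length ≤ K := by
  rintro ⟨K, hK⟩
  obtain ⟨n₀, hn₀⟩ := stub_perExitsUnbounded hM K
  obtain ⟨w, hvalid, hprod, hle⟩ := hK n₀
  have := hn₀ n₀ le_rfl w hvalid hprod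
  omega

/-! ## The FORK is sandwiched between `S` / `¬X_ℝ` and `LengthBudget → S` -/

/-- **`S` implies the FORK** (vacuously: beyond `n₀(c)` no word has few exits). [folklore] -/
theorem fork_of_signBudget
    (hS : ∀ c : ℕ, ∃ n₀ : ℕ, ∀ n ≥ n₀, ∀ w : List (Fin 3 × Fin 3 × ℝ × Option (Fin n × Fin n)),
      (∀ l ∈ w, l.1 ≠ l.2.1) →
      (w.map (fun l => Matrix.transvection l.1 l.2.1
        (MvPolynomial.C l.2.2.1 * l.2.2.2.elim 1 MvPolynomial.X))).prod =
        Matrix.transvection (0 : Fin 3) 2 (perPoly (Fin n) ℝ) →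
      2 ^ ((Nat.log 2 n + c) ^ c) < (w.filter (fun l => !decide (0 < l.2.2.1 ∧
          (l.1.val + 1 = l.2.1.val ∨ l.2.1.val + 1 = l.1.val)))).length)
    (c : ℕ) :
    ∃ c' n₁ : ℕ, ∀ n ≥ n₁, ∀ w : List (Fin 3 × Fin 3 × ℝ × Option (Fin n × Fin n)),
      (∀ l ∈ w, l.1 ≠ l.2.1) →
      (w.map (fun l => Matrix.transvection l.1 l.2.1
        (MvPolynomial.C l.2.2.1 * l.2.2.2.elim 1 MvPolynomial.X))).prod =
        Matrix.transvection (0 : Fin 3) 2 (perPoly (Fin n) ℝ) →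
      (w.filter (fun l => !decide (0 < l.2.2.1 ∧
          (l.1.val + 1 = l.2.1.val ∨ l.2.1.val + 1 = l.1.val)))).length ≤
        2 ^ ((Nat.log 2 n + c) ^ c) →
      ∃ w' : List (Fin 3 × Fin 3 × ℝ × Option (Fin n × Fin n)),
        (∀ l ∈ w', l.1 ≠ l.2.1) ∧
        (w'.map (fun l => Matrix.transvection l.1 l.2.1
          (MvPolynomial.C l.2.2.1 * l.2.2.2.elim 1 MvPolynomial.X))).prod =
          Matrix.transvection (0 : Fin 3) 2 (perPoly (Fin n) ℝ) ∧
        w'.length ≤ 2 ^ ((Nat.log 2 n + c') ^ c') := by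
  obtain ⟨n₀, hn₀⟩ := hS c
  refine ⟨c, n₀, fun n hn w hvalid hprod hle => ?_⟩
  exact absurd (hn₀ n hn w hvalid hprod) (not_lt.mpr hle)

/-- **The negation of the (realified, all-`n`) crux implies the FORK**: if quasi-polynomial real
words exist for every `n`, they serve as the short replacement. [folklore] -/
theorem fork_of_qpRealWords
    (h : ∃ c : ℕ, ∀ n : ℕ, ∃ w : List (Fin 3 × Fin 3 × ℝ × Option (Fin n × Fin n)),
      (∀ l ∈ w, l.1 ≠ l.2.1) ∧
      (w.map (fun l => Matrix.transvection l.1 l.2.1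
        (MvPolynomial.C l.2.2.1 * l.2.2.2.elim 1 MvPolynomial.X))).prod =
        Matrix.transvection (0 : Fin 3) 2 (perPoly (Fin n) ℝ) ∧
      w.length ≤ 2 ^ ((Nat.log 2 n + c) ^ c))
    (c : ℕ) :
    ∃ c' n₁ : ℕ, ∀ n ≥ n₁, ∀ w : List (Fin 3 × Fin 3 × ℝ × Option (Fin n × Fin n)),
      (∀ l ∈ w, l.1 ≠ l.2.1) →
      (w.map (fun l => Matrix.transvection l.1 l.2.1
        (MvPolynomial.C l.2.2.1 * l.2.2.2.elim 1 MvPolynomial.X))).prod =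
        Matrix.transvection (0 : Fin 3) 2 (perPoly (Fin n) ℝ) →
      (w.filter (fun l => !decide (0 < l.2.2.1 ∧
          (l.1.val + 1 = l.2.1.val ∨ l.2.1.val + 1 = l.1.val)))).length ≤
        2 ^ ((Nat.log 2 n + c) ^ c) →
      ∃ w' : List (Fin 3 × Fin 3 × ℝ × Option (Fin n × Fin n)),
        (∀ l ∈ w', l.1 ≠ l.2.1) ∧
        (w'.map (fun l => Matrix.transvection l.1 l.2.1
          (MvPolynomial.C l.2.2.1 * l.2.2.2.elim 1 MvPolynomial.X))).prod =
          Matrix.transvection (0 : Fin 3) 2 (perPoly (Fin n) ℝ) ∧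
        w'.length ≤ 2 ^ ((Nat.log 2 n + c') ^ c') := by
  obtain ⟨c₀, hc₀⟩ := h
  refine ⟨c₀, 0, fun n _hn _w _hvalid _hprod _hle => ?_⟩
  obtain ⟨w', hw', hprod', hlen⟩ := hc₀ n
  exact ⟨w', hw', hprod', hlen⟩

/-- **FORK ⇒ (LengthBudget → S)** (the planner's tripwire `signBudget_iff_lengthBudget_of_fork`,
direction used by the line; stated inline): under exit-to-length normalisation, the eventual
length budget for `E₀₂(per_n)` forces the eventual exit budget. [folklore] -/
theorem signBudget_of_fork_of_lengthBudget
    (hF : ∀ c : ℕ, ∃ c' n₁ : ℕ, ∀ n ≥ n₁, ∀ w : List (Fin 3 × Fin 3 × ℝ × Option (Fin n × Fin n)),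
      (∀ l ∈ w, l.1 ≠ l.2.1) →
      (w.map (fun l => Matrix.transvection l.1 l.2.1
        (MvPolynomial.C l.2.2.1 * l.2.2.2.elim 1 MvPolynomial.X))).prod =
        Matrix.transvection (0 : Fin 3) 2 (perPoly (Fin n) ℝ) →
      (w.filter (fun l => !decide (0 < l.2.2.1 ∧
          (l.1.val + 1 = l.2.1.val ∨ l.2.1.val + 1 = l.1.val)))).length ≤
        2 ^ ((Nat.log 2 n + c) ^ c) →
      ∃ w' : List (Fin 3 × Fin 3 × ℝ × Option (Fin n × Fin n)),
        (∀ l ∈ w', l.1 ≠ l.2.1) ∧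
        (w'.map (fun l => Matrix.transvection l.1 l.2.1
          (MvPolynomial.C l.2.2.1 * l.2.2.2.elim 1 MvPolynomial.X))).prod =
          Matrix.transvection (0 : Fin 3) 2 (perPoly (Fin n) ℝ) ∧
        w'.length ≤ 2 ^ ((Nat.log 2 n + c') ^ c'))
    (hL : ∀ c : ℕ, ∃ n₀ : ℕ, ∀ n ≥ n₀, ∀ w : List (Fin 3 × Fin 3 × ℝ × Option (Fin n × Fin n)),
      (∀ l ∈ w, l.1 ≠ l.2.1) →
      (w.map (fun l => Matrix.transvection l.1 l.2.1
        (MvPolynomial.C l.2.2.1 * l.2.2.2.elim 1 MvPolynomial.X))).prod =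
        Matrix.transvection (0 : Fin 3) 2 (perPoly (Fin n) ℝ) →
      2 ^ ((Nat.log 2 n + c) ^ c) < w.length)
    (c : ℕ) :
    ∃ n₀ : ℕ, ∀ n ≥ n₀, ∀ w : List (Fin 3 × Fin 3 × ℝ × Option (Fin n × Fin n)),
      (∀ l ∈ w, l.1 ≠ l.2.1) →
      (w.map (fun l => Matrix.transvection l.1 l.2.1
        (MvPolynomial.C l.2.2.1 * l.2.2.2.elim 1 MvPolynomial.X))).prod =
        Matrix.transvection (0 : Fin 3) 2 (perPoly (Fin n) ℝ) →
      2 ^ ((Nat.log 2 n + c) ^ c) < (w.filter (fun l => !decide (0 < l.2.2.1 ∧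
          (l.1.val + 1 = l.2.1.val ∨ l.2.1.val + 1 = l.1.val)))).length := by
  obtain ⟨c', n₁, hn₁⟩ := hF c
  obtain ⟨n₀, hn₀⟩ := hL c'
  refine ⟨max n₀ n₁, fun n hn w hvalid hprod => ?_⟩
  by_contra hle
  obtain ⟨w', hw', hprod', hlen⟩ :=
    hn₁ n (le_trans (le_max_right _ _) hn) w hvalid hprod (not_lt.mp hle)
  have := hn₀ n (le_trans (le_max_left _ _) hn) w' hw' hprod'
  omega

end Summit.ValiantsHypothesis.ValiantsHypothesis.Cruxes.WordLengthQP.PositiveMonoidExits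

end
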